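import Literature.NumberTheory.Automorphic.UpqGKModuleBigradedLevels   -- ★ (A-p14 (g23)): N3b `upqEStep`, `upqFStep`, `upqLevel`, `q`-reduction; N3a `upqLieC`, `upqEOp`, `upqFOp`
import HarnessLib

/-!
# `U(2,1)`: the root operators `E₀, E₁, F₀, F₁`, the `𝔰𝔩₂`-triple `(e, f, h)` of `𝔨_ℂ`, and the monomials `F₀^j F₁^k E₀^i E₁^l`

Topic `NumberTheory/Automorphic`; namespace `Literature.NumberTheory.Automorphic`.  DEFINITIONS with bodies (`u21E`, `u21F`, `u21e`, `u21f`, `u21h`,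
`u21Mon`) and theorems; no named fact, no instance, no notation, no `sorry`.  Cell `hodgecm-mathlib`, F0∕P3, T1a arch line, road «V19 in-house for
`U(2,1)`» (registered pay-down line `Cruxes/H413/Lines/F0_T1a_V19KTypeGrowthPaydown.lean`, one open stub `stub_N3 : LevelBound₂₁`): node **N3c**
«`U(2,1)` root calculus» (seat A-p14 (g23); LEAD F0P3b-p01 (g2)), over N3a ★ `UpqComplexifiedAction` and N3b ★ `UpqGKModuleBigradedLevels`.

THE MATHEMATICS ([BorelWallach2000, II §4.1–4.2]; [KnappVogan1995, §IV.1]; [Varadarajan1989, §5.4]).  For `(𝔤, K)`-module data `(ρK, ρ𝔤)` of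
`U(2,1) = uFormGroup (Fin 2) (Fin 1)` on `V`, write (via the complexified action `ρ_ℂ` ★ `upqLieC`) `E_j := ρ_ℂ(E_{j2})` (`𝔭⁺`), `F_j := ρ_ℂ(E_{2j})` (`𝔭⁻`),
`j ∈ {0,1}`, and `e := ρ_ℂ(E_{01})`, `f := ρ_ℂ(E_{10})`, `h := ρ_ℂ(E_{00} − E_{11})` — the `𝔰𝔩₂`-triple of `𝔨_ℂ = 𝔤𝔩₂ ⊕ 𝔤𝔩₁`.  Then (all from the
matrix-unit multiplication table through the Lie homomorphism `ρ_ℂ`):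
* §1 `[E₀, E₁] = 0 = [F₀, F₁]`; `[e, f] = h`, `[h, e] = 2e`, `[h, f] = −2f`; `[e, E₁] = E₀`, `[e, E₀] = 0`, `[e, F₀] = −F₁`, `[e, F₁] = 0`;
  `[f, E₀] = E₁`, `[f, E₁] = 0`, `[f, F₁] = −F₀`, `[f, F₀] = 0`; `[h, E₀] = E₀`, `[h, E₁] = −E₁`, `[h, F₀] = −F₀`, `[h, F₁] = F₁`; `e, f, h` preserve
  every `𝔨`-stable subspace and lie in the subalgebra generated by `ρ𝔤(𝔨)` (so the tree's TRANSPORT LEMMA ★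
  `IsGKModule.IntertwiningMap.apply_eq_of_apply_eq_of_mem_adjoin` applies to them);
* §2 the MONOMIALS `M(j,k,i,l) := F₀^j F₁^k E₀^i E₁^l` (`u21Mon`): `M(j,k,i,l) W₀ ⊆ M_{i+l, j+k}` (★ `upqLevel`), and the level `M_{a,b} = F^b E^a W₀` is the
  SPAN of the `M(j, b−j, i, a−i) w` (`w ∈ W₀`); the DERIVATION FORMULAS `h M = M h + (k − j + i − l) M`,
  `f M(j,k,i,l) = M f − k M(j+1,k−1,i,l) + i M(j,k,i−1,l+1)`, `e M(j,k,i,l) = M e − j M(j−1,k+1,i,l) + l M(j,k,i+1,l−1)`;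
* §3 the `q`-REDUCTION (N3b ★ `upq_sum_upqFOp_upqEOp_apply_mem_upqLevel_zero`, `q = F₀E₀ + F₁E₁`): for `K`-stable `W₀` and a scalar Casimir,
  `M(j+1,k,i+1,l) w + M(j,k+1,i,l+1) w ∈ M_{i+l, j+k}` — one pair `F₀E₀` is traded for `−F₁E₁` modulo TWO LEVELS DOWN; hence modulo `F_{a+b−2}` the
  level `M_{a,b}` is spanned by the `a+b+1` REDUCED families `η_{−j} = M(j, b−j, 0, a)` (`0 ≤ j ≤ b`), `η_i = M(0, b, i, a−i)` (`1 ≤ i ≤ a`) applied to `W₀`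
  — the harmonic quotient `𝓗^{a,b} ⊗ W₀ ↠ M_{a,b} ∕ lower`, `dim 𝓗^{a,b} = a+b+1`.

HONEST LABEL: kernel definitions∕theorems about abstract `(𝔤, K)`-modules of `U(2,1)`; nothing printed about HC_CM is discharged here.  HC_CM is proved only
modulo the 2 remaining named inputs (hLiu418, h413) until rung 0 closes.

## References
* A. Borel, N. Wallach, *Continuous Cohomology, Discrete Subgroups, and Representations of Reductive Groups*, 2nd ed. (2000), II §4.1–4.2. [BorelWallach2000]
* A. W. Knapp, D. A. Vogan, *Cohomological Induction and Unitary Representations* (1995), §IV.1. [KnappVogan1995]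
* V. S. Varadarajan, *An Introduction to Harmonic Analysis on Semisimple Lie Groups* (1989), §5.4. [Varadarajan1989]
-/

-- Mathlib idiom (as in ★ `GKModules` and every `(𝔤, K)` file of the tree): the commutator bracket on `Module.End ℂ V` and on matrices, needed to
-- MENTION `ρ𝔤 : (uFormGroup α β).lie →ₗ⁅ℝ⁆ Module.End ℂ V` (`LieRing.ofAssociativeRing` is a `def` in Mathlib, not a global instance).
attribute [local instance 100] LieRing.ofAssociativeRing

set_option autoImplicit false

open scoped MatrixGroups Matrix ComplexConjugate

noncomputable section

namespace Literature.NumberTheory.Automorphic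

open Literature.RepresentationTheory Literature.RepresentationTheory.BorelWallach2000 Literature.RepresentationTheory.KonnoKonno2007

variable {V : Type*} [AddCommGroup V] [Module ℂ V]
  (ρK : Representation ℂ (uFormGroup (Fin 2) (Fin 1)).maximalCompact V) (ρ𝔤 : (uFormGroup (Fin 2) (Fin 1)).lie →ₗ⁅ℝ⁆ Module.End ℂ V)

/-! ## §0 A derivation lemma -/

/-- If `D A = A D + B` and `A B = B A` then `D Aⁿ = Aⁿ D + n Aⁿ⁻¹ B` (Leibniz for the inner derivation `[D, ·]` on powers). [folklore] -/
private theorem mul_pow_eq_of_mul_eq {R : Type*} [Ring R] (D A B : R) (h : D * A = A * D + B) (hAB : A * B = B * A) (n : ℕ) :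
    D * A ^ n = A ^ n * D + n • (A ^ (n - 1) * B) := by
  induction n with
  | zero => simp
  | succ n ih =>
    rw [pow_succ, ← mul_assoc, ih, add_mul, mul_assoc (A ^ n) D A, h, mul_add, ← mul_assoc, ← pow_succ, Nat.add_sub_cancel, succ_nsmul,
      smul_mul_assoc, mul_assoc (A ^ (n - 1)) B A, ← hAB, add_assoc]
    congr 1
    rcases Nat.eq_zero_or_pos n with rfl | hn
    · simp
    · rw [← mul_assoc, ← pow_succ, Nat.sub_add_cancel hn, add_comm]

/-! ## §1 Root operators and the `𝔰𝔩₂`-triple of `𝔨_ℂ` -/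

/-- **`E_j := E_{E_{j,2}} = ρ_ℂ(E_{j2})`** (`j = 0, 1`), the root operators of `𝔭⁺ ≅ ℂ²` (★ `upqEOp` at the matrix unit). [cite: BorelWallach2000, II §4.1] -/
def u21E (j : Fin 2) : Module.End ℂ V := upqEOp ρ𝔤 (Matrix.single j (0 : Fin 1) (1 : ℂ))

/-- **`F_j := F_{E_{2,j}} = ρ_ℂ(E_{2j})`** (`j = 0, 1`), the root operators of `𝔭⁻` (★ `upqFOp` at the matrix unit). [cite: BorelWallach2000, II §4.1] -/
def u21F (j : Fin 2) : Module.End ℂ V := upqFOp ρ𝔤 (Matrix.single (0 : Fin 1) j (1 : ℂ))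

/-- **`e := ρ_ℂ(E_{01})`**, the raising operator of `𝔰𝔩₂ ⊂ 𝔨_ℂ`. [cite: KnappVogan1995, §IV.1] -/
def u21e : Module.End ℂ V := upqLieC ρ𝔤 (Matrix.fromBlocks (Matrix.single 0 1 (1 : ℂ)) 0 0 (0 : Matrix (Fin 1) (Fin 1) ℂ))

/-- **`f := ρ_ℂ(E_{10})`**, the lowering operator of `𝔰𝔩₂ ⊂ 𝔨_ℂ`. [cite: KnappVogan1995, §IV.1] -/
def u21f : Module.End ℂ V := upqLieC ρ𝔤 (Matrix.fromBlocks (Matrix.single 1 0 (1 : ℂ)) 0 0 (0 : Matrix (Fin 1) (Fin 1) ℂ))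

/-- **`h := ρ_ℂ(E_{00} − E_{11})`**, the Cartan element of `𝔰𝔩₂ ⊂ 𝔨_ℂ`. [cite: KnappVogan1995, §IV.1] -/
def u21h : Module.End ℂ V := upqLieC ρ𝔤 (Matrix.fromBlocks (Matrix.single 0 0 (1 : ℂ) - Matrix.single 1 1 (1 : ℂ)) 0 0 (0 : Matrix (Fin 1) (Fin 1) ℂ))

/-- Unfolding of `E_j`. [cite: BorelWallach2000, II §4.1] -/
theorem u21E_def (j : Fin 2) : u21E ρ𝔤 j = upqEOp ρ𝔤 (Matrix.single j (0 : Fin 1) (1 : ℂ)) := rfl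

/-- Unfolding of `F_j`. [cite: BorelWallach2000, II §4.1] -/
theorem u21F_def (j : Fin 2) : u21F ρ𝔤 j = upqFOp ρ𝔤 (Matrix.single (0 : Fin 1) j (1 : ℂ)) := rfl

/-- **`𝔭⁺` is abelian: `E_j E_{j'} = E_{j'} E_j`.** [cite: BorelWallach2000, II §4.2] -/
theorem u21E_comm (j j' : Fin 2) : u21E ρ𝔤 j * u21E ρ𝔤 j' = u21E ρ𝔤 j' * u21E ρ𝔤 j := upqEOp_comm ρ𝔤 _ _

/-- **`𝔭⁻` is abelian: `F_j F_{j'} = F_{j'} F_j`.** [cite: BorelWallach2000, II §4.2] -/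
theorem u21F_comm (j j' : Fin 2) : u21F ρ𝔤 j * u21F ρ𝔤 j' = u21F ρ𝔤 j' * u21F ρ𝔤 j := upqFOp_comm ρ𝔤 _ _

/-- `[e, E₁] = E₀`. [cite: BorelWallach2000, II §4.1] -/
theorem u21e_mul_u21E_one : u21e ρ𝔤 * u21E ρ𝔤 1 = u21E ρ𝔤 1 * u21e ρ𝔤 + u21E ρ𝔤 0 := by
  have h := upqLieC_diag_mul_upqEOp_sub ρ𝔤 (Matrix.single (0 : Fin 2) (1 : Fin 2) (1 : ℂ)) (0 : Matrix (Fin 1) (Fin 1) ℂ) (Matrix.single (1 : Fin 2) (0 : Fin 1) (1 : ℂ))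
  have hm : (Matrix.single (0 : Fin 2) (1 : Fin 2) (1 : ℂ)) * (Matrix.single (1 : Fin 2) (0 : Fin 1) (1 : ℂ)) - (Matrix.single (1 : Fin 2) (0 : Fin 1) (1 : ℂ)) * (0 : Matrix (Fin 1) (Fin 1) ℂ) = Matrix.single (0 : Fin 2) (0 : Fin 1) (1 : ℂ) := by
    ext i j; fin_cases i <;> fin_cases j <;> simp
  rw [hm] at h
  exact sub_eq_iff_eq_add'.mp h

/-- `[e, E₀] = 0`. [cite: BorelWallach2000, II §4.1] -/
theorem u21e_mul_u21E_zero : u21e ρ𝔤 * u21E ρ𝔤 0 = u21E ρ𝔤 0 * u21e ρ𝔤 := by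
  have h := upqLieC_diag_mul_upqEOp_sub ρ𝔤 (Matrix.single (0 : Fin 2) (1 : Fin 2) (1 : ℂ)) (0 : Matrix (Fin 1) (Fin 1) ℂ) (Matrix.single (0 : Fin 2) (0 : Fin 1) (1 : ℂ))
  have hm : (Matrix.single (0 : Fin 2) (1 : Fin 2) (1 : ℂ)) * (Matrix.single (0 : Fin 2) (0 : Fin 1) (1 : ℂ)) - (Matrix.single (0 : Fin 2) (0 : Fin 1) (1 : ℂ)) * (0 : Matrix (Fin 1) (Fin 1) ℂ) = 0 := by
    ext i j; fin_cases i <;> fin_cases j <;> simp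
  rw [hm] at h
  rw [map_zero] at h
  exact sub_eq_zero.mp h

/-- `[e, F₀] = −F₁`. [cite: BorelWallach2000, II §4.1] -/
theorem u21e_mul_u21F_zero : u21e ρ𝔤 * u21F ρ𝔤 0 = u21F ρ𝔤 0 * u21e ρ𝔤 - u21F ρ𝔤 1 := by
  have h := upqLieC_diag_mul_upqFOp_sub ρ𝔤 (Matrix.single (0 : Fin 2) (1 : Fin 2) (1 : ℂ)) (0 : Matrix (Fin 1) (Fin 1) ℂ) (Matrix.single (0 : Fin 1) (0 : Fin 2) (1 : ℂ))
  have hm : (0 : Matrix (Fin 1) (Fin 1) ℂ) * (Matrix.single (0 : Fin 1) (0 : Fin 2) (1 : ℂ)) - (Matrix.single (0 : Fin 1) (0 : Fin 2) (1 : ℂ)) * (Matrix.single (0 : Fin 2) (1 : Fin 2) (1 : ℂ)) = -(Matrix.single (0 : Fin 1) (1 : Fin 2) (1 : ℂ)) := by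
    ext i j; fin_cases i; fin_cases j <;> simp
  rw [hm] at h
  rw [map_neg] at h
  rw [sub_eq_add_neg]
  exact sub_eq_iff_eq_add'.mp h

/-- `[e, F₁] = 0`. [cite: BorelWallach2000, II §4.1] -/
theorem u21e_mul_u21F_one : u21e ρ𝔤 * u21F ρ𝔤 1 = u21F ρ𝔤 1 * u21e ρ𝔤 := by
  have h := upqLieC_diag_mul_upqFOp_sub ρ𝔤 (Matrix.single (0 : Fin 2) (1 : Fin 2) (1 : ℂ)) (0 : Matrix (Fin 1) (Fin 1) ℂ) (Matrix.single (0 : Fin 1) (1 : Fin 2) (1 : ℂ))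
  have hm : (0 : Matrix (Fin 1) (Fin 1) ℂ) * (Matrix.single (0 : Fin 1) (1 : Fin 2) (1 : ℂ)) - (Matrix.single (0 : Fin 1) (1 : Fin 2) (1 : ℂ)) * (Matrix.single (0 : Fin 2) (1 : Fin 2) (1 : ℂ)) = 0 := by
    ext i j; fin_cases i; fin_cases j <;> simp
  rw [hm] at h
  rw [map_zero] at h
  exact sub_eq_zero.mp h

/-- `[f, E₀] = E₁`. [cite: BorelWallach2000, II §4.1] -/
theorem u21f_mul_u21E_zero : u21f ρ𝔤 * u21E ρ𝔤 0 = u21E ρ𝔤 0 * u21f ρ𝔤 + u21E ρ𝔤 1 := by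
  have h := upqLieC_diag_mul_upqEOp_sub ρ𝔤 (Matrix.single (1 : Fin 2) (0 : Fin 2) (1 : ℂ)) (0 : Matrix (Fin 1) (Fin 1) ℂ) (Matrix.single (0 : Fin 2) (0 : Fin 1) (1 : ℂ))
  have hm : (Matrix.single (1 : Fin 2) (0 : Fin 2) (1 : ℂ)) * (Matrix.single (0 : Fin 2) (0 : Fin 1) (1 : ℂ)) - (Matrix.single (0 : Fin 2) (0 : Fin 1) (1 : ℂ)) * (0 : Matrix (Fin 1) (Fin 1) ℂ) = Matrix.single (1 : Fin 2) (0 : Fin 1) (1 : ℂ) := by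
    ext i j; fin_cases i <;> fin_cases j <;> simp
  rw [hm] at h
  exact sub_eq_iff_eq_add'.mp h

/-- `[f, E₁] = 0`. [cite: BorelWallach2000, II §4.1] -/
theorem u21f_mul_u21E_one : u21f ρ𝔤 * u21E ρ𝔤 1 = u21E ρ𝔤 1 * u21f ρ𝔤 := by
  have h := upqLieC_diag_mul_upqEOp_sub ρ𝔤 (Matrix.single (1 : Fin 2) (0 : Fin 2) (1 : ℂ)) (0 : Matrix (Fin 1) (Fin 1) ℂ) (Matrix.single (1 : Fin 2) (0 : Fin 1) (1 : ℂ))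
  have hm : (Matrix.single (1 : Fin 2) (0 : Fin 2) (1 : ℂ)) * (Matrix.single (1 : Fin 2) (0 : Fin 1) (1 : ℂ)) - (Matrix.single (1 : Fin 2) (0 : Fin 1) (1 : ℂ)) * (0 : Matrix (Fin 1) (Fin 1) ℂ) = 0 := by
    ext i j; fin_cases i <;> fin_cases j <;> simp
  rw [hm] at h
  rw [map_zero] at h
  exact sub_eq_zero.mp h

/-- `[f, F₁] = −F₀`. [cite: BorelWallach2000, II §4.1] -/
theorem u21f_mul_u21F_one : u21f ρ𝔤 * u21F ρ𝔤 1 = u21F ρ𝔤 1 * u21f ρ𝔤 - u21F ρ𝔤 0 := by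
  have h := upqLieC_diag_mul_upqFOp_sub ρ𝔤 (Matrix.single (1 : Fin 2) (0 : Fin 2) (1 : ℂ)) (0 : Matrix (Fin 1) (Fin 1) ℂ) (Matrix.single (0 : Fin 1) (1 : Fin 2) (1 : ℂ))
  have hm : (0 : Matrix (Fin 1) (Fin 1) ℂ) * (Matrix.single (0 : Fin 1) (1 : Fin 2) (1 : ℂ)) - (Matrix.single (0 : Fin 1) (1 : Fin 2) (1 : ℂ)) * (Matrix.single (1 : Fin 2) (0 : Fin 2) (1 : ℂ)) = -(Matrix.single (0 : Fin 1) (0 : Fin 2) (1 : ℂ)) := by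
    ext i j; fin_cases i; fin_cases j <;> simp
  rw [hm] at h
  rw [map_neg] at h
  rw [sub_eq_add_neg]
  exact sub_eq_iff_eq_add'.mp h

/-- `[f, F₀] = 0`. [cite: BorelWallach2000, II §4.1] -/
theorem u21f_mul_u21F_zero : u21f ρ𝔤 * u21F ρ𝔤 0 = u21F ρ𝔤 0 * u21f ρ𝔤 := by
  have h := upqLieC_diag_mul_upqFOp_sub ρ𝔤 (Matrix.single (1 : Fin 2) (0 : Fin 2) (1 : ℂ)) (0 : Matrix (Fin 1) (Fin 1) ℂ) (Matrix.single (0 : Fin 1) (0 : Fin 2) (1 : ℂ))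
  have hm : (0 : Matrix (Fin 1) (Fin 1) ℂ) * (Matrix.single (0 : Fin 1) (0 : Fin 2) (1 : ℂ)) - (Matrix.single (0 : Fin 1) (0 : Fin 2) (1 : ℂ)) * (Matrix.single (1 : Fin 2) (0 : Fin 2) (1 : ℂ)) = 0 := by
    ext i j; fin_cases i; fin_cases j <;> simp
  rw [hm] at h
  rw [map_zero] at h
  exact sub_eq_zero.mp h

/-- `[h, E₀] = E₀`. [cite: BorelWallach2000, II §4.1] -/
theorem u21h_mul_u21E_zero : u21h ρ𝔤 * u21E ρ𝔤 0 = u21E ρ𝔤 0 * u21h ρ𝔤 + u21E ρ𝔤 0 := by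
  have h := upqLieC_diag_mul_upqEOp_sub ρ𝔤 (Matrix.single (0 : Fin 2) (0 : Fin 2) (1 : ℂ) - Matrix.single (1 : Fin 2) (1 : Fin 2) (1 : ℂ)) (0 : Matrix (Fin 1) (Fin 1) ℂ) (Matrix.single (0 : Fin 2) (0 : Fin 1) (1 : ℂ))
  have hm : (Matrix.single (0 : Fin 2) (0 : Fin 2) (1 : ℂ) - Matrix.single (1 : Fin 2) (1 : Fin 2) (1 : ℂ)) * (Matrix.single (0 : Fin 2) (0 : Fin 1) (1 : ℂ)) - (Matrix.single (0 : Fin 2) (0 : Fin 1) (1 : ℂ)) * (0 : Matrix (Fin 1) (Fin 1) ℂ) = Matrix.single (0 : Fin 2) (0 : Fin 1) (1 : ℂ) := by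
    ext i j; fin_cases i <;> fin_cases j <;> simp
  rw [hm] at h
  exact sub_eq_iff_eq_add'.mp h

/-- `[h, E₁] = −E₁`. [cite: BorelWallach2000, II §4.1] -/
theorem u21h_mul_u21E_one : u21h ρ𝔤 * u21E ρ𝔤 1 = u21E ρ𝔤 1 * u21h ρ𝔤 - u21E ρ𝔤 1 := by
  have h := upqLieC_diag_mul_upqEOp_sub ρ𝔤 (Matrix.single (0 : Fin 2) (0 : Fin 2) (1 : ℂ) - Matrix.single (1 : Fin 2) (1 : Fin 2) (1 : ℂ)) (0 : Matrix (Fin 1) (Fin 1) ℂ) (Matrix.single (1 : Fin 2) (0 : Fin 1) (1 : ℂ))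
  have hm : (Matrix.single (0 : Fin 2) (0 : Fin 2) (1 : ℂ) - Matrix.single (1 : Fin 2) (1 : Fin 2) (1 : ℂ)) * (Matrix.single (1 : Fin 2) (0 : Fin 1) (1 : ℂ)) - (Matrix.single (1 : Fin 2) (0 : Fin 1) (1 : ℂ)) * (0 : Matrix (Fin 1) (Fin 1) ℂ) = -(Matrix.single (1 : Fin 2) (0 : Fin 1) (1 : ℂ)) := by
    ext i j; fin_cases i <;> fin_cases j <;> simp
  rw [hm] at h
  rw [map_neg] at h
  rw [sub_eq_add_neg]
  exact sub_eq_iff_eq_add'.mp h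

/-- `[h, F₀] = −F₀`. [cite: BorelWallach2000, II §4.1] -/
theorem u21h_mul_u21F_zero : u21h ρ𝔤 * u21F ρ𝔤 0 = u21F ρ𝔤 0 * u21h ρ𝔤 - u21F ρ𝔤 0 := by
  have h := upqLieC_diag_mul_upqFOp_sub ρ𝔤 (Matrix.single (0 : Fin 2) (0 : Fin 2) (1 : ℂ) - Matrix.single (1 : Fin 2) (1 : Fin 2) (1 : ℂ)) (0 : Matrix (Fin 1) (Fin 1) ℂ) (Matrix.single (0 : Fin 1) (0 : Fin 2) (1 : ℂ))
  have hm : (0 : Matrix (Fin 1) (Fin 1) ℂ) * (Matrix.single (0 : Fin 1) (0 : Fin 2) (1 : ℂ)) - (Matrix.single (0 : Fin 1) (0 : Fin 2) (1 : ℂ)) * (Matrix.single (0 : Fin 2) (0 : Fin 2) (1 : ℂ) - Matrix.single (1 : Fin 2) (1 : Fin 2) (1 : ℂ)) = -(Matrix.single (0 : Fin 1) (0 : Fin 2) (1 : ℂ)) := by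
    ext i j; fin_cases i; fin_cases j <;> simp
  rw [hm] at h
  rw [map_neg] at h
  rw [sub_eq_add_neg]
  exact sub_eq_iff_eq_add'.mp h

/-- `[h, F₁] = F₁`. [cite: BorelWallach2000, II §4.1] -/
theorem u21h_mul_u21F_one : u21h ρ𝔤 * u21F ρ𝔤 1 = u21F ρ𝔤 1 * u21h ρ𝔤 + u21F ρ𝔤 1 := by
  have h := upqLieC_diag_mul_upqFOp_sub ρ𝔤 (Matrix.single (0 : Fin 2) (0 : Fin 2) (1 : ℂ) - Matrix.single (1 : Fin 2) (1 : Fin 2) (1 : ℂ)) (0 : Matrix (Fin 1) (Fin 1) ℂ) (Matrix.single (0 : Fin 1) (1 : Fin 2) (1 : ℂ))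
  have hm : (0 : Matrix (Fin 1) (Fin 1) ℂ) * (Matrix.single (0 : Fin 1) (1 : Fin 2) (1 : ℂ)) - (Matrix.single (0 : Fin 1) (1 : Fin 2) (1 : ℂ)) * (Matrix.single (0 : Fin 2) (0 : Fin 2) (1 : ℂ) - Matrix.single (1 : Fin 2) (1 : Fin 2) (1 : ℂ)) = Matrix.single (0 : Fin 1) (1 : Fin 2) (1 : ℂ) := by
    ext i j; fin_cases i; fin_cases j <;> simp
  rw [hm] at h
  exact sub_eq_iff_eq_add'.mp h

/-- `[[X,0],[0,0]] · [[Y,0],[0,0]] − [[Y,0],[0,0]] · [[X,0],[0,0]] = [[XY − YX,0],[0,0]]`. [folklore] -/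
private theorem fromBlocks_diag_comm (X Y : Matrix (Fin 2) (Fin 2) ℂ) :
    Matrix.fromBlocks X 0 0 (0 : Matrix (Fin 1) (Fin 1) ℂ) * Matrix.fromBlocks Y 0 0 0 - Matrix.fromBlocks Y 0 0 0 * Matrix.fromBlocks X 0 0 0 =
      Matrix.fromBlocks (X * Y - Y * X) 0 0 0 := by
  rw [Matrix.fromBlocks_multiply, Matrix.fromBlocks_multiply, sub_eq_add_neg, Matrix.fromBlocks_neg, Matrix.fromBlocks_add]
  simp [sub_eq_add_neg]

/-- **`[e, f] = h`.** [cite: KnappVogan1995, §IV.1] -/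
theorem u21e_mul_u21f_sub : u21e ρ𝔤 * u21f ρ𝔤 - u21f ρ𝔤 * u21e ρ𝔤 = u21h ρ𝔤 := by
  rw [u21e, u21f, u21h, ← upqLieC_mul_sub_mul, fromBlocks_diag_comm]
  congr 2
  ext i j; fin_cases i <;> fin_cases j <;> simp

/-- **`[h, e] = 2e`.** [cite: KnappVogan1995, §IV.1] -/
theorem u21h_mul_u21e_sub : u21h ρ𝔤 * u21e ρ𝔤 - u21e ρ𝔤 * u21h ρ𝔤 = (2 : ℂ) • u21e ρ𝔤 := by
  rw [u21e, u21h, ← upqLieC_mul_sub_mul, ← map_smul, fromBlocks_diag_comm, Matrix.fromBlocks_smul, smul_zero, smul_zero, smul_zero]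
  congr 2
  ext i j; fin_cases i <;> fin_cases j <;> norm_num [Matrix.mul_apply, Matrix.single_apply]

/-- **`[h, f] = −2f`.** [cite: KnappVogan1995, §IV.1] -/
theorem u21h_mul_u21f_sub : u21h ρ𝔤 * u21f ρ𝔤 - u21f ρ𝔤 * u21h ρ𝔤 = -((2 : ℂ) • u21f ρ𝔤) := by
  rw [u21f, u21h, ← upqLieC_mul_sub_mul, ← map_smul, ← map_neg, fromBlocks_diag_comm, Matrix.fromBlocks_smul, Matrix.fromBlocks_neg, smul_zero,
    neg_zero]
  congr 2 <;> try simp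
  ext i j; fin_cases i <;> fin_cases j <;> norm_num [Matrix.mul_apply, Matrix.single_apply]

/-- `e`, `f`, `h` preserve every `𝔨`-stable complex subspace (they lie in `ρ_ℂ(𝔨_ℂ)`). [cite: KnappVogan1995, §IV.1] -/
theorem u21e_apply_mem {U : Submodule ℂ V} (hU : ∀ Y ∈ (uFormGroup (Fin 2) (Fin 1)).kInLie, ∀ u ∈ U, ρ𝔤 Y u ∈ U) {u : V} (hu : u ∈ U) :
    u21e ρ𝔤 u ∈ U := upqLieC_fromBlocks_diag_apply_mem ρ𝔤 _ _ hU hu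

/-- `f` preserves every `𝔨`-stable complex subspace. [cite: KnappVogan1995, §IV.1] -/
theorem u21f_apply_mem {U : Submodule ℂ V} (hU : ∀ Y ∈ (uFormGroup (Fin 2) (Fin 1)).kInLie, ∀ u ∈ U, ρ𝔤 Y u ∈ U) {u : V} (hu : u ∈ U) :
    u21f ρ𝔤 u ∈ U := upqLieC_fromBlocks_diag_apply_mem ρ𝔤 _ _ hU hu

/-- `h` preserves every `𝔨`-stable complex subspace. [cite: KnappVogan1995, §IV.1] -/
theorem u21h_apply_mem {U : Submodule ℂ V} (hU : ∀ Y ∈ (uFormGroup (Fin 2) (Fin 1)).kInLie, ∀ u ∈ U, ρ𝔤 Y u ∈ U) {u : V} (hu : u ∈ U) :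
    u21h ρ𝔤 u ∈ U := upqLieC_fromBlocks_diag_apply_mem ρ𝔤 _ _ hU hu

/-- **`ρ_ℂ` of a block-diagonal matrix lies in the subalgebra generated by `ρ𝔤(𝔨)`** (its real and imaginary parts are in `𝔨`) — so the tree's TRANSPORT
LEMMA (★ `IsGKModule.IntertwiningMap.apply_eq_of_apply_eq_of_mem_adjoin`) applies to `e`, `f`, `h`. [cite: KnappVogan1995, §I.4 (1.64)–(1.65)] -/
theorem upqLieC_fromBlocks_diag_mem_adjoin {α β : Type} [Fintype α] [DecidableEq α] [Fintype β] [DecidableEq β]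
    (ρ𝔤 : (uFormGroup α β).lie →ₗ⁅ℝ⁆ Module.End ℂ V) (D₁ : Matrix α α ℂ) (D₂ : Matrix β β ℂ) :
    upqLieC ρ𝔤 (Matrix.fromBlocks D₁ 0 0 D₂) ∈
      Algebra.adjoin ℂ (Set.range fun Y : (uFormGroup α β).compactLie => ρ𝔤 (LieSubalgebra.inclusion (uFormGroup α β).compactLie_le_lie Y)) := by
  have hθ : upqTheta α β (Matrix.fromBlocks D₁ 0 0 D₂) = Matrix.fromBlocks (-D₁ᴴ) 0 0 (-D₂ᴴ) := by
    rw [upqTheta_fromBlocks]; simp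
  have hA : upqRePart α β (Matrix.fromBlocks D₁ 0 0 D₂) ∈ (uFormGroup α β).kInLie := by
    rw [upq_mem_kInLie_iff_blocks, coe_upqRePart, hθ, Matrix.fromBlocks_add, Matrix.fromBlocks_smul, Matrix.toBlocks_fromBlocks₁₂, add_zero, smul_zero]
  have hB : upqImPart α β (Matrix.fromBlocks D₁ 0 0 D₂) ∈ (uFormGroup α β).kInLie := by
    rw [upq_mem_kInLie_iff_blocks, coe_upqImPart, hθ, sub_eq_add_neg, Matrix.fromBlocks_neg, Matrix.fromBlocks_add, Matrix.fromBlocks_smul,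
      Matrix.fromBlocks_smul, Matrix.toBlocks_fromBlocks₁₂, neg_zero, add_zero, smul_zero, smul_zero]
  obtain ⟨YA, hYA⟩ := hA
  obtain ⟨YB, hYB⟩ := hB
  rw [upqLieC_apply, ← hYA, ← hYB]
  refine Subalgebra.add_mem _ ?_ (Subalgebra.smul_mem _ ?_ _)
  · exact Algebra.subset_adjoin ⟨YA, rfl⟩
  · exact Algebra.subset_adjoin ⟨YB, rfl⟩

/-- `e` lies in the subalgebra generated by `ρ𝔤(𝔨)`. [cite: KnappVogan1995, §I.4 (1.64)–(1.65)] -/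
theorem u21e_mem_adjoin : u21e ρ𝔤 ∈ Algebra.adjoin ℂ (Set.range fun Y : (uFormGroup (Fin 2) (Fin 1)).compactLie =>
    ρ𝔤 (LieSubalgebra.inclusion (uFormGroup (Fin 2) (Fin 1)).compactLie_le_lie Y)) :=
  upqLieC_fromBlocks_diag_mem_adjoin ρ𝔤 _ _

/-- `f` lies in the subalgebra generated by `ρ𝔤(𝔨)`. [cite: KnappVogan1995, §I.4 (1.64)–(1.65)] -/
theorem u21f_mem_adjoin : u21f ρ𝔤 ∈ Algebra.adjoin ℂ (Set.range fun Y : (uFormGroup (Fin 2) (Fin 1)).compactLie =>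
    ρ𝔤 (LieSubalgebra.inclusion (uFormGroup (Fin 2) (Fin 1)).compactLie_le_lie Y)) :=
  upqLieC_fromBlocks_diag_mem_adjoin ρ𝔤 _ _

/-- `h` lies in the subalgebra generated by `ρ𝔤(𝔨)`. [cite: KnappVogan1995, §I.4 (1.64)–(1.65)] -/
theorem u21h_mem_adjoin : u21h ρ𝔤 ∈ Algebra.adjoin ℂ (Set.range fun Y : (uFormGroup (Fin 2) (Fin 1)).compactLie =>
    ρ𝔤 (LieSubalgebra.inclusion (uFormGroup (Fin 2) (Fin 1)).compactLie_le_lie Y)) :=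
  upqLieC_fromBlocks_diag_mem_adjoin ρ𝔤 _ _

/-! ## §2 The monomials `M(j,k,i,l) = F₀^j F₁^k E₀^i E₁^l` -/

/-- **`M(j,k,i,l) := F₀^j F₁^k E₀^i E₁^l`** (as an operator: first `E₁^l`, then `E₀^i`, `F₁^k`, `F₀^j`). [cite: Varadarajan1989, §5.4] -/
def u21Mon (j k i l : ℕ) : Module.End ℂ V := u21F ρ𝔤 0 ^ j * u21F ρ𝔤 1 ^ k * u21E ρ𝔤 0 ^ i * u21E ρ𝔤 1 ^ l

/-- Unfolding of `M(j,k,i,l)`. [cite: Varadarajan1989, §5.4] -/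
theorem u21Mon_def (j k i l : ℕ) : u21Mon ρ𝔤 j k i l = u21F ρ𝔤 0 ^ j * u21F ρ𝔤 1 ^ k * u21E ρ𝔤 0 ^ i * u21E ρ𝔤 1 ^ l := rfl

variable {ρ𝔤}

/-- `E_j` maps the iterate `E^{[m]} U` into `E^{[m+1]} U`. [cite: Varadarajan1989, §5.3 (proof of Thm. 10)] -/
theorem u21E_apply_mem_iterate_upqEStep (j : Fin 2) {U : Submodule ℂ V} (m : ℕ) {u : V} (hu : u ∈ (upqEStep ρ𝔤)^[m] U) :
    u21E ρ𝔤 j u ∈ (upqEStep ρ𝔤)^[m + 1] U := by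
  rw [Function.iterate_succ_apply']
  exact upqEOp_single_apply_mem_upqEStep (j, (0 : Fin 1)) hu

/-- `F_j` maps `F^{[m]} X` into `F^{[m+1]} X`. [cite: Varadarajan1989, §5.3 (proof of Thm. 10)] -/
theorem u21F_apply_mem_iterate_upqFStep (j : Fin 2) {X : Submodule ℂ V} (m : ℕ) {u : V} (hu : u ∈ (upqFStep ρ𝔤)^[m] X) :
    u21F ρ𝔤 j u ∈ (upqFStep ρ𝔤)^[m + 1] X := by
  rw [Function.iterate_succ_apply']
  exact upqFOp_single_apply_mem_upqFStep ((j : Fin 2), (0 : Fin 1)) (U := (upqFStep ρ𝔤)^[m] X) hu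

/-- Powers `E_j^i` map `E^{[m]} U` into `E^{[m+i]} U`. [cite: Varadarajan1989, §5.3 (proof of Thm. 10)] -/
theorem u21E_pow_apply_mem_iterate_upqEStep (j : Fin 2) {U : Submodule ℂ V} (m i : ℕ) {u : V} (hu : u ∈ (upqEStep ρ𝔤)^[m] U) :
    (u21E ρ𝔤 j ^ i) u ∈ (upqEStep ρ𝔤)^[m + i] U := by
  induction i with
  | zero => simpa using hu
  | succ i ih =>
    rw [pow_succ', Module.End.mul_apply, ← add_assoc]
    exact u21E_apply_mem_iterate_upqEStep j _ ih

/-- Powers `F_j^k` map `F^{[m]} X` into `F^{[m+k]} X`. [cite: Varadarajan1989, §5.3 (proof of Thm. 10)] -/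
theorem u21F_pow_apply_mem_iterate_upqFStep (j : Fin 2) {X : Submodule ℂ V} (m k : ℕ) {u : V} (hu : u ∈ (upqFStep ρ𝔤)^[m] X) :
    (u21F ρ𝔤 j ^ k) u ∈ (upqFStep ρ𝔤)^[m + k] X := by
  induction k with
  | zero => simpa using hu
  | succ k ih =>
    rw [pow_succ', Module.End.mul_apply, ← add_assoc]
    exact u21F_apply_mem_iterate_upqFStep j _ ih

/-- **`M(j,k,i,l) W₀ ⊆ M_{i+l, j+k}`** (★ `upqLevel`). [cite: Varadarajan1989, §5.4] -/
theorem u21Mon_apply_mem_upqLevel {W₀ : Submodule ℂ V} (j k i l : ℕ) {w : V} (hw : w ∈ W₀) :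
    u21Mon ρ𝔤 j k i l w ∈ upqLevel ρ𝔤 W₀ (i + l) (j + k) := by
  rw [u21Mon_def, Module.End.mul_apply, Module.End.mul_apply, Module.End.mul_apply, upqLevel]
  have h1 : (u21E ρ𝔤 1 ^ l) w ∈ (upqEStep ρ𝔤)^[l] W₀ := by
    simpa using u21E_pow_apply_mem_iterate_upqEStep 1 (U := W₀) 0 l (by simpa using hw)
  have h2 : (u21E ρ𝔤 0 ^ i) ((u21E ρ𝔤 1 ^ l) w) ∈ (upqEStep ρ𝔤)^[i + l] W₀ := by
    rw [add_comm]; exact u21E_pow_apply_mem_iterate_upqEStep 0 l i h1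
  have h3 : (u21F ρ𝔤 1 ^ k) ((u21E ρ𝔤 0 ^ i) ((u21E ρ𝔤 1 ^ l) w)) ∈ (upqFStep ρ𝔤)^[k] ((upqEStep ρ𝔤)^[i + l] W₀) := by
    simpa using u21F_pow_apply_mem_iterate_upqFStep 1 (X := (upqEStep ρ𝔤)^[i + l] W₀) 0 k (by simpa using h2)
  rw [add_comm j k]
  exact u21F_pow_apply_mem_iterate_upqFStep 0 k j h3

/-- **`M(j,k,i,l) W₀ ⊆ F_{i+l+j+k}`** (★ `upqPFiltration`). [cite: Varadarajan1989, §5.4] -/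
theorem u21Mon_apply_mem_upqPFiltration {W₀ : Submodule ℂ V} (j k i l : ℕ) {w : V} (hw : w ∈ W₀) :
    u21Mon ρ𝔤 j k i l w ∈ upqPFiltration ρ𝔤 W₀ (i + l + (j + k)) :=
  upqLevel_le_upqPFiltration W₀ _ _ (u21Mon_apply_mem_upqLevel j k i l hw)

/-- `E₀ M(0,0,i,l) = M(0,0,i+1,l)`. [cite: Varadarajan1989, §5.4] -/
theorem u21E_zero_mul_u21Mon (i l : ℕ) : u21E ρ𝔤 0 * u21Mon ρ𝔤 0 0 i l = u21Mon ρ𝔤 0 0 (i + 1) l := by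
  simp only [u21Mon_def, pow_zero, one_mul, pow_succ', mul_assoc]

/-- `E₁ M(0,0,i,l) = M(0,0,i,l+1)` (`E₁` commutes past `E₀^i`). [cite: Varadarajan1989, §5.4] -/
theorem u21E_one_mul_u21Mon (i l : ℕ) : u21E ρ𝔤 1 * u21Mon ρ𝔤 0 0 i l = u21Mon ρ𝔤 0 0 i (l + 1) := by
  have hc : u21E ρ𝔤 1 * u21E ρ𝔤 0 ^ i = u21E ρ𝔤 0 ^ i * u21E ρ𝔤 1 :=
    (Commute.pow_right (show Commute (u21E ρ𝔤 1) (u21E ρ𝔤 0) from u21E_comm ρ𝔤 1 0) i).eq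
  simp only [u21Mon_def, pow_zero, one_mul]
  rw [← mul_assoc, hc, mul_assoc, ← pow_succ']

/-- `F₀ M(j,k,i,l) = M(j+1,k,i,l)`. [cite: Varadarajan1989, §5.4] -/
theorem u21F_zero_mul_u21Mon (j k i l : ℕ) : u21F ρ𝔤 0 * u21Mon ρ𝔤 j k i l = u21Mon ρ𝔤 (j + 1) k i l := by
  simp only [u21Mon_def, pow_succ', mul_assoc]

/-- `F₁ M(j,k,i,l) = M(j,k+1,i,l)` (`F₁` commutes past `F₀^j`). [cite: Varadarajan1989, §5.4] -/
theorem u21F_one_mul_u21Mon (j k i l : ℕ) : u21F ρ𝔤 1 * u21Mon ρ𝔤 j k i l = u21Mon ρ𝔤 j (k + 1) i l := by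
  have hc : u21F ρ𝔤 1 * u21F ρ𝔤 0 ^ j = u21F ρ𝔤 0 ^ j * u21F ρ𝔤 1 :=
    (Commute.pow_right (show Commute (u21F ρ𝔤 1) (u21F ρ𝔤 0) from u21F_comm ρ𝔤 1 0) j).eq
  rw [u21Mon_def, u21Mon_def, ← mul_assoc, ← mul_assoc, ← mul_assoc, hc, mul_assoc (u21F ρ𝔤 0 ^ j), ← pow_succ']

variable (ρ𝔤) in
/-- **The level `M_{a,b} = F^b E^a W₀` IS SPANNED BY THE MONOMIALS `M(j, b−j, i, a−i) w`** (`j ≤ b`, `i ≤ a`, `w ∈ W₀`).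
[cite: Varadarajan1989, §5.4] [cite: BorelWallach2000, II §4.2] -/
theorem upqLevel_eq_span_u21Mon (W₀ : Submodule ℂ V) (a b : ℕ) :
    upqLevel ρ𝔤 W₀ a b = Submodule.span ℂ {v | ∃ j ≤ b, ∃ i ≤ a, ∃ w ∈ W₀, v = u21Mon ρ𝔤 j (b - j) i (a - i) w} := by
  apply le_antisymm
  · -- by induction: first the `E`-levels `M_{a,0}`, then the `F`-steps
    have hE : ∀ a : ℕ, upqLevel ρ𝔤 W₀ a 0 ≤ Submodule.span ℂ {v | ∃ i ≤ a, ∃ w ∈ W₀, v = u21Mon ρ𝔤 0 0 i (a - i) w} := by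
      intro a
      induction a with
      | zero =>
        intro w hw
        exact Submodule.subset_span ⟨0, le_rfl, w, hw, by simp [u21Mon_def]⟩
      | succ a ih =>
        rw [upqLevel_succ_left_zero]
        refine (upqEStep_mono ih).trans ?_
        rw [upqEStep, iSup_le_iff]
        intro p
        rw [Submodule.map_span, Submodule.span_le]
        rintro _ ⟨v, ⟨i, hi, w, hw, rfl⟩, rfl⟩
        obtain ⟨p1, p2⟩ := p
        have hp2 : p2 = 0 := Subsingleton.elim _ _
        subst hp2
        fin_cases p1
        · refine Submodule.subset_span ⟨i + 1, by omega, w, hw, ?_⟩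
          show (upqEOp ρ𝔤 (Matrix.single (0 : Fin 2) (0 : Fin 1) 1)) (u21Mon ρ𝔤 0 0 i (a - i) w) = _
          rw [← u21E_def, ← Module.End.mul_apply, u21E_zero_mul_u21Mon, show a + 1 - (i + 1) = a - i by omega]
        · refine Submodule.subset_span ⟨i, by omega, w, hw, ?_⟩
          show (upqEOp ρ𝔤 (Matrix.single (1 : Fin 2) (0 : Fin 1) 1)) (u21Mon ρ𝔤 0 0 i (a - i) w) = _
          rw [← u21E_def, ← Module.End.mul_apply, u21E_one_mul_u21Mon, show a + 1 - i = a - i + 1 by omega]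
    induction b with
    | zero =>
      refine (hE a).trans (Submodule.span_mono ?_)
      rintro v ⟨i, hi, w, hw, rfl⟩
      exact ⟨0, le_rfl, i, hi, w, hw, rfl⟩
    | succ b ih =>
      rw [upqLevel_succ_right]
      refine (upqFStep_mono ih).trans ?_
      rw [upqFStep, iSup_le_iff]
      intro p
      rw [Submodule.map_span, Submodule.span_le]
      rintro _ ⟨v, ⟨j, hj, i, hi, w, hw, rfl⟩, rfl⟩
      obtain ⟨p1, p2⟩ := p
      have hp2 : p2 = 0 := Subsingleton.elim _ _
      subst hp2
      fin_cases p1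
      · refine Submodule.subset_span ⟨j + 1, by omega, i, hi, w, hw, ?_⟩
        show (upqFOp ρ𝔤 (Matrix.single (0 : Fin 1) (0 : Fin 2) 1)) (u21Mon ρ𝔤 j (b - j) i (a - i) w) = _
        rw [← u21F_def, ← Module.End.mul_apply, u21F_zero_mul_u21Mon, show b + 1 - (j + 1) = b - j by omega]
      · refine Submodule.subset_span ⟨j, by omega, i, hi, w, hw, ?_⟩
        show (upqFOp ρ𝔤 (Matrix.single (0 : Fin 1) (1 : Fin 2) 1)) (u21Mon ρ𝔤 j (b - j) i (a - i) w) = _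
        rw [← u21F_def, ← Module.End.mul_apply, u21F_one_mul_u21Mon, show b + 1 - j = b - j + 1 by omega]
  · rw [Submodule.span_le]
    rintro _ ⟨j, hj, i, hi, w, hw, rfl⟩
    have h := u21Mon_apply_mem_upqLevel (ρ𝔤 := ρ𝔤) j (b - j) i (a - i) hw
    rwa [show i + (a - i) = a by omega, show j + (b - j) = b by omega] at h

/-! ### Derivation formulas -/

/-- `n (X^(n-1) X) = n X^n` (also for `n = 0`, where both sides vanish). [folklore] -/
private theorem nsmul_pow_pred_mul {R : Type*} [Ring R] (X : R) (n : ℕ) : n • (X ^ (n - 1) * X) = n • X ^ n := by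
  rcases Nat.eq_zero_or_pos n with rfl | hn
  · simp
  · rw [← pow_succ, Nat.sub_add_cancel hn]

/-- **`h M(j,k,i,l) = M(j,k,i,l) h + (k − j + i − l) M(j,k,i,l)`** — the monomial has `h`-weight `k − j + i − l`. [cite: Varadarajan1989, §5.4] -/
theorem u21h_mul_u21Mon (j k i l : ℕ) :
    u21h ρ𝔤 * u21Mon ρ𝔤 j k i l = u21Mon ρ𝔤 j k i l * u21h ρ𝔤 + ((k : ℂ) - j + i - l) • u21Mon ρ𝔤 j k i l := by
  -- conjugation of `h` past each power, in right-associated form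
  have hF0 : ∀ R : Module.End ℂ V, u21h ρ𝔤 * (u21F ρ𝔤 0 ^ j * R) = u21F ρ𝔤 0 ^ j * (u21h ρ𝔤 * R) - (j : ℂ) • (u21F ρ𝔤 0 ^ j * R) := by
    intro R
    have h0 := mul_pow_eq_of_mul_eq _ _ _ (show u21h ρ𝔤 * u21F ρ𝔤 0 = u21F ρ𝔤 0 * u21h ρ𝔤 + -u21F ρ𝔤 0 by
      rw [u21h_mul_u21F_zero, sub_eq_add_neg]) (by rw [mul_neg, neg_mul]) j
    rw [mul_neg, smul_neg, nsmul_pow_pred_mul, ← Nat.cast_smul_eq_nsmul ℂ] at h0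
    rw [← mul_assoc, h0, add_mul, neg_mul, smul_mul_assoc, mul_assoc, ← sub_eq_add_neg]
  have hF1 : ∀ R : Module.End ℂ V, u21h ρ𝔤 * (u21F ρ𝔤 1 ^ k * R) = u21F ρ𝔤 1 ^ k * (u21h ρ𝔤 * R) + (k : ℂ) • (u21F ρ𝔤 1 ^ k * R) := by
    intro R
    have h0 := mul_pow_eq_of_mul_eq _ _ _ (u21h_mul_u21F_one ρ𝔤) rfl k
    rw [nsmul_pow_pred_mul, ← Nat.cast_smul_eq_nsmul ℂ] at h0
    rw [← mul_assoc, h0, add_mul, smul_mul_assoc, mul_assoc]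
  have hE0 : ∀ R : Module.End ℂ V, u21h ρ𝔤 * (u21E ρ𝔤 0 ^ i * R) = u21E ρ𝔤 0 ^ i * (u21h ρ𝔤 * R) + (i : ℂ) • (u21E ρ𝔤 0 ^ i * R) := by
    intro R
    have h0 := mul_pow_eq_of_mul_eq _ _ _ (u21h_mul_u21E_zero ρ𝔤) rfl i
    rw [nsmul_pow_pred_mul, ← Nat.cast_smul_eq_nsmul ℂ] at h0
    rw [← mul_assoc, h0, add_mul, smul_mul_assoc, mul_assoc]
  have hE1 : u21h ρ𝔤 * u21E ρ𝔤 1 ^ l = u21E ρ𝔤 1 ^ l * u21h ρ𝔤 - (l : ℂ) • u21E ρ𝔤 1 ^ l := by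
    have h0 := mul_pow_eq_of_mul_eq _ _ _ (show u21h ρ𝔤 * u21E ρ𝔤 1 = u21E ρ𝔤 1 * u21h ρ𝔤 + -u21E ρ𝔤 1 by
      rw [u21h_mul_u21E_one, sub_eq_add_neg]) (by rw [mul_neg, neg_mul]) l
    rw [mul_neg, smul_neg, nsmul_pow_pred_mul, ← Nat.cast_smul_eq_nsmul ℂ, ← sub_eq_add_neg] at h0
    exact h0
  rw [u21Mon_def]
  simp only [mul_assoc]
  rw [hF0, hF1, hE0, hE1]
  simp only [mul_sub, mul_add, mul_smul_comm]
  module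

/-- **`f M(j,k,i,l) = M(j,k,i,l) f − k M(j+1,k−1,i,l) + i M(j,k,i−1,l+1)`** (`[f,F₁] = −F₀`, `[f,E₀] = E₁`, `[f,F₀] = [f,E₁] = 0`).
[cite: Varadarajan1989, §5.4] -/
theorem u21f_mul_u21Mon (j k i l : ℕ) :
    u21f ρ𝔤 * u21Mon ρ𝔤 j k i l = u21Mon ρ𝔤 j k i l * u21f ρ𝔤 - k • u21Mon ρ𝔤 (j + 1) (k - 1) i l + i • u21Mon ρ𝔤 j k (i - 1) (l + 1) := by
  have hF0 : ∀ R : Module.End ℂ V, u21f ρ𝔤 * (u21F ρ𝔤 0 ^ j * R) = u21F ρ𝔤 0 ^ j * (u21f ρ𝔤 * R) := by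
    intro R
    rw [← mul_assoc, (Commute.pow_right (show Commute (u21f ρ𝔤) (u21F ρ𝔤 0) from u21f_mul_u21F_zero ρ𝔤) j).eq, mul_assoc]
  have hF1 : ∀ R : Module.End ℂ V, u21f ρ𝔤 * (u21F ρ𝔤 1 ^ k * R) =
      u21F ρ𝔤 1 ^ k * (u21f ρ𝔤 * R) - k • (u21F ρ𝔤 0 * (u21F ρ𝔤 1 ^ (k - 1) * R)) := by
    intro R
    have h0 := mul_pow_eq_of_mul_eq _ _ _ (show u21f ρ𝔤 * u21F ρ𝔤 1 = u21F ρ𝔤 1 * u21f ρ𝔤 + -u21F ρ𝔤 0 by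
      rw [u21f_mul_u21F_one, sub_eq_add_neg]) (by rw [mul_neg, neg_mul, u21F_comm]) k
    have hc : u21F ρ𝔤 1 ^ (k - 1) * u21F ρ𝔤 0 = u21F ρ𝔤 0 * u21F ρ𝔤 1 ^ (k - 1) :=
      (Commute.pow_left (show Commute (u21F ρ𝔤 1) (u21F ρ𝔤 0) from u21F_comm ρ𝔤 1 0) (k - 1)).eq
    rw [mul_neg, smul_neg, hc] at h0
    rw [← mul_assoc, h0, add_mul, neg_mul, smul_mul_assoc, mul_assoc, mul_assoc, ← sub_eq_add_neg]
  have hE0 : ∀ R : Module.End ℂ V, u21f ρ𝔤 * (u21E ρ𝔤 0 ^ i * R) =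
      u21E ρ𝔤 0 ^ i * (u21f ρ𝔤 * R) + i • (u21E ρ𝔤 0 ^ (i - 1) * (u21E ρ𝔤 1 * R)) := by
    intro R
    have h0 := mul_pow_eq_of_mul_eq _ _ _ (u21f_mul_u21E_zero ρ𝔤) (u21E_comm ρ𝔤 0 1) i
    rw [← mul_assoc, h0, add_mul, smul_mul_assoc, mul_assoc, mul_assoc]
  have hE1 : u21f ρ𝔤 * u21E ρ𝔤 1 ^ l = u21E ρ𝔤 1 ^ l * u21f ρ𝔤 :=
    (Commute.pow_right (show Commute (u21f ρ𝔤) (u21E ρ𝔤 1) from u21f_mul_u21E_one ρ𝔤) l).eq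
  rw [u21Mon_def, u21Mon_def, u21Mon_def, pow_succ (u21F ρ𝔤 0) j, pow_succ' (u21E ρ𝔤 1) l]
  simp only [mul_assoc]
  rw [hF0, hF1, hE0, hE1]
  simp only [mul_sub, mul_add, mul_smul_comm]
  module

/-- **`e M(j,k,i,l) = M(j,k,i,l) e − j M(j−1,k+1,i,l) + l M(j,k,i+1,l−1)`** (`[e,F₀] = −F₁`, `[e,E₁] = E₀`, `[e,F₁] = [e,E₀] = 0`).
[cite: Varadarajan1989, §5.4] -/
theorem u21e_mul_u21Mon (j k i l : ℕ) :
    u21e ρ𝔤 * u21Mon ρ𝔤 j k i l = u21Mon ρ𝔤 j k i l * u21e ρ𝔤 - j • u21Mon ρ𝔤 (j - 1) (k + 1) i l + l • u21Mon ρ𝔤 j k (i + 1) (l - 1) := by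
  have hF0 : ∀ R : Module.End ℂ V, u21e ρ𝔤 * (u21F ρ𝔤 0 ^ j * R) =
      u21F ρ𝔤 0 ^ j * (u21e ρ𝔤 * R) - j • (u21F ρ𝔤 0 ^ (j - 1) * (u21F ρ𝔤 1 * R)) := by
    intro R
    have h0 := mul_pow_eq_of_mul_eq _ _ _ (show u21e ρ𝔤 * u21F ρ𝔤 0 = u21F ρ𝔤 0 * u21e ρ𝔤 + -u21F ρ𝔤 1 by
      rw [u21e_mul_u21F_zero, sub_eq_add_neg]) (by rw [mul_neg, neg_mul, u21F_comm]) j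
    rw [mul_neg, smul_neg] at h0
    rw [← mul_assoc, h0, add_mul, neg_mul, smul_mul_assoc, mul_assoc, mul_assoc, ← sub_eq_add_neg]
  have hF1 : ∀ R : Module.End ℂ V, u21e ρ𝔤 * (u21F ρ𝔤 1 ^ k * R) = u21F ρ𝔤 1 ^ k * (u21e ρ𝔤 * R) := by
    intro R
    rw [← mul_assoc, (Commute.pow_right (show Commute (u21e ρ𝔤) (u21F ρ𝔤 1) from u21e_mul_u21F_one ρ𝔤) k).eq, mul_assoc]
  have hE0 : ∀ R : Module.End ℂ V, u21e ρ𝔤 * (u21E ρ𝔤 0 ^ i * R) = u21E ρ𝔤 0 ^ i * (u21e ρ𝔤 * R) := by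
    intro R
    rw [← mul_assoc, (Commute.pow_right (show Commute (u21e ρ𝔤) (u21E ρ𝔤 0) from u21e_mul_u21E_zero ρ𝔤) i).eq, mul_assoc]
  have hE1 : u21e ρ𝔤 * u21E ρ𝔤 1 ^ l = u21E ρ𝔤 1 ^ l * u21e ρ𝔤 + l • (u21E ρ𝔤 0 * u21E ρ𝔤 1 ^ (l - 1)) := by
    have h0 := mul_pow_eq_of_mul_eq _ _ _ (u21e_mul_u21E_one ρ𝔤) (u21E_comm ρ𝔤 1 0) l
    have hc : u21E ρ𝔤 1 ^ (l - 1) * u21E ρ𝔤 0 = u21E ρ𝔤 0 * u21E ρ𝔤 1 ^ (l - 1) :=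
      (Commute.pow_left (show Commute (u21E ρ𝔤 1) (u21E ρ𝔤 0) from u21E_comm ρ𝔤 1 0) (l - 1)).eq
    rw [hc] at h0
    exact h0
  rw [u21Mon_def, u21Mon_def, u21Mon_def, pow_succ' (u21F ρ𝔤 1) k, pow_succ (u21E ρ𝔤 0) i]
  simp only [mul_assoc]
  rw [hF0, hF1, hE0, hE1]
  simp only [mul_add, mul_smul_comm]
  module

/-! ## §3 The `q`-reduction modulo two levels down -/

/-- `q = Σ_p F_p E_p = F₀ E₀ + F₁ E₁` for `U(2,1)`. [cite: BorelWallach2000, II §4.2] -/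
theorem u21_sum_upqFOp_upqEOp_eq (u : V) :
    (∑ p : Fin 2 × Fin 1, upqFOp ρ𝔤 (Matrix.single p.2 p.1 1) (upqEOp ρ𝔤 (Matrix.single p.1 p.2 1) u)) =
      u21F ρ𝔤 0 (u21E ρ𝔤 0 u) + u21F ρ𝔤 1 (u21E ρ𝔤 1 u) := by
  rw [Fintype.sum_prod_type, Fin.sum_univ_two, Fintype.sum_unique, Fintype.sum_unique]
  rfl

/-- **`q`-REDUCTION**: `M(j+1,k,i+1,l) w + M(j,k+1,i,l+1) w ∈ M_{i+l, j+k}` for `w ∈ W₀`, `W₀` `K`-stable, Casimir scalar — the pair `F₀ E₀` is traded for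
`−F₁ E₁` modulo TWO LEVELS DOWN (`F₀E₀ = q − F₁E₁` and `q M_{a,0} ⊆ M_{a,0}`, ★ `upq_sum_upqFOp_upqEOp_apply_mem_upqLevel_zero`).
[cite: Varadarajan1989, §5.4 (proof of Thm. 22)] [cite: BorelWallach2000, II §4.2] -/
theorem u21Mon_succ_add_u21Mon_succ_apply_mem (hV : IsGKModule (uFormGroup (Fin 2) (Fin 1)) ρK ρ𝔤) {c : ℂ}
    (hC : upqCasimirOp ρ𝔤 = algebraMap ℂ (Module.End ℂ V) c) {W₀ : Submodule ℂ V}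
    (hW₀ : ∀ (k : (uFormGroup (Fin 2) (Fin 1)).maximalCompact), ∀ w ∈ W₀, ρK k w ∈ W₀) (j k i l : ℕ) {w : V} (hw : w ∈ W₀) :
    u21Mon ρ𝔤 (j + 1) k (i + 1) l w + u21Mon ρ𝔤 j (k + 1) i (l + 1) w ∈ upqLevel ρ𝔤 W₀ (i + l) (j + k) := by
  -- `u := E₀^i E₁^l w ∈ M_{i+l, 0}` and `q u ∈ M_{i+l,0}`
  set u := (u21E ρ𝔤 0 ^ i * u21E ρ𝔤 1 ^ l) w with hu_def
  have hu : u ∈ upqLevel ρ𝔤 W₀ (i + l) 0 := by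
    have := u21Mon_apply_mem_upqLevel (ρ𝔤 := ρ𝔤) 0 0 i l hw
    simpa [u21Mon_def, hu_def, Module.End.mul_apply] using this
  have hq : u21F ρ𝔤 0 (u21E ρ𝔤 0 u) + u21F ρ𝔤 1 (u21E ρ𝔤 1 u) ∈ upqLevel ρ𝔤 W₀ (i + l) 0 := by
    rw [← u21_sum_upqFOp_upqEOp_eq]
    exact upq_sum_upqFOp_upqEOp_apply_mem_upqLevel_zero ρK hV hC hW₀ (i + l) hu
  -- `F₀^j F₁^k` maps `M_{i+l,0}` into `M_{i+l, j+k}`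
  have hFF : ∀ {x : V}, x ∈ upqLevel ρ𝔤 W₀ (i + l) 0 → (u21F ρ𝔤 0 ^ j * u21F ρ𝔤 1 ^ k) x ∈ upqLevel ρ𝔤 W₀ (i + l) (j + k) := by
    intro x hx
    rw [Module.End.mul_apply, upqLevel, add_comm j k]
    refine u21F_pow_apply_mem_iterate_upqFStep 0 k j ?_
    simpa using u21F_pow_apply_mem_iterate_upqFStep 1 (X := (upqEStep ρ𝔤)^[i + l] W₀) 0 k (by simpa [upqLevel] using hx)
  -- the identity `M(j+1,k,i+1,l) w + M(j,k+1,i,l+1) w = F₀^j F₁^k (F₀E₀ u + F₁E₁ u)`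
  have hid : u21Mon ρ𝔤 (j + 1) k (i + 1) l w + u21Mon ρ𝔤 j (k + 1) i (l + 1) w =
      (u21F ρ𝔤 0 ^ j * u21F ρ𝔤 1 ^ k) (u21F ρ𝔤 0 (u21E ρ𝔤 0 u) + u21F ρ𝔤 1 (u21E ρ𝔤 1 u)) := by
    have h1 : u21Mon ρ𝔤 (j + 1) k (i + 1) l = u21F ρ𝔤 0 ^ j * u21F ρ𝔤 1 ^ k * (u21F ρ𝔤 0 * u21E ρ𝔤 0) * (u21E ρ𝔤 0 ^ i * u21E ρ𝔤 1 ^ l) := by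
      rw [u21Mon_def, pow_succ (u21F ρ𝔤 0) j, pow_succ' (u21E ρ𝔤 0) i]
      have hc : u21F ρ𝔤 0 * u21F ρ𝔤 1 ^ k = u21F ρ𝔤 1 ^ k * u21F ρ𝔤 0 :=
        (Commute.pow_right (show Commute (u21F ρ𝔤 0) (u21F ρ𝔤 1) from u21F_comm ρ𝔤 0 1) k).eq
      simp only [mul_assoc]
      rw [← mul_assoc (u21F ρ𝔤 0) (u21F ρ𝔤 1 ^ k), hc]
      simp only [mul_assoc]
    have h2 : u21Mon ρ𝔤 j (k + 1) i (l + 1) = u21F ρ𝔤 0 ^ j * u21F ρ𝔤 1 ^ k * (u21F ρ𝔤 1 * u21E ρ𝔤 1) * (u21E ρ𝔤 0 ^ i * u21E ρ𝔤 1 ^ l) := by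
      rw [u21Mon_def, pow_succ (u21F ρ𝔤 1) k, pow_succ' (u21E ρ𝔤 1) l]
      have hc : u21E ρ𝔤 1 * u21E ρ𝔤 0 ^ i = u21E ρ𝔤 0 ^ i * u21E ρ𝔤 1 :=
        (Commute.pow_right (show Commute (u21E ρ𝔤 1) (u21E ρ𝔤 0) from u21E_comm ρ𝔤 1 0) i).eq
      simp only [mul_assoc]
      rw [← mul_assoc (u21E ρ𝔤 1) (u21E ρ𝔤 0 ^ i), hc]
      simp only [mul_assoc]
    rw [h1, h2, hu_def]
    simp only [Module.End.mul_apply, map_add]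
  rw [hid]
  exact hFF hq

end Literature.NumberTheory.Automorphic

end
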